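import Mathlib
import Summits.NavierStokesRegularity.FluidComputer.AbcInertiaCIExactlyPair
import Summits.NavierStokesRegularity.FluidComputer.AbcClassIEigenpairRow5001CClassical

/-!
# INERTIA-3L, CLASS I — «EXACTLY THE HOPF PAIR» AT `R = 500`: the linearisation about the forced ABC flow has
# EXACTLY TWO classical class-I eigenvalues with `Re z ≥ 1/4`, the Hopf pair `λ⋆, conj λ⋆` of `Row5001C`
# (instab3 g9, cell `ns-blowup`, 2026-08-27)

HONEST FRAMING (human rulings D-0035/D-0074): **MODEL linear operator, computer-assisted; not NS.** Nothing
here is a statement about Navier–Stokes regularity or blow-up. Object: the linearisation of forced NS about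
`U = abcFlow 1 1 1` on the unit torus at viscosity `1/(2π·500)` (`R = 500`), symmetry CLASS I (cert-3 g9's
`AbcClassI` layer). bears_on LADDER-NS N1* T6 («leader order at R 500: the class-II steady mode vs the class-I
Hopf pair — the LEADER FLIP between R 300 and R 500») / profile W3. WHAT THIS IS NOT: not NS; no certificate
re-run; no number or census word moves.

The `R = 500` sibling of `AbcInertiaCIExactlyPair` (R 300): `a_le_row5001C` (`1/4 ≤ Row5001C.lamRe − ρ`) and
**`R500I_exactly_pair_i4`** — the T2 row `Row5001C` (class I, implementation C = profile-cert-3, K₀ = 22,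
K_V = 96, complex orbit bases `wf`; hypotheses VERBATIM those of
`AbcClassIEigenpair.row5001C_classI_eigenpairs_of_complex_bases`) AND the INERTIA-3L class-I cell
`(500, I, 1/4, 2; 36, 37)` of IMPLEMENTATION 2 (instab4 g8, `inertia_cert_R500_cI_rL36_rH37.json`, kit j274542 —
SINGLE implementation at R 500; (R1)(R2) on `AbcClassI.amat` VERBATIM as in `AbcInertiaCIRows.R500I_rL36_rH37_card_le_two`)
⇒ `σ_p(L_500|I) ∩ {Re ≥ 1/4} = {λ⋆, conj λ⋆}`, `|λ⋆ − (0.2853678… + 0.6452862… i)| ≤ Row5001C.rho` (5.9·10⁻⁹).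
What is NOT kernel: the row's primary interval outputs and (R1)(R2) (the programs' verified arithmetic),
AUDIT-BASIS (class-I INERTIA hypotheses over the tree's bases `AbcClassI.bfam`).

Mathlib + the two files named; no new definitions; std axioms. [folklore]
-/

noncomputable section

open scoped BigOperators ComplexConjugate InnerProductSpace Matrix
open Finset Matrix MeasureTheory UnitAddTorus

namespace Summit.NavierStokesRegularity.FluidComputer.AbcInertiaCI

open Literature.Analysis.FunctionSpaces Literature.Analysis.FunctionSpaces.Torus
open Literature.Analysis.FluidPDE
open Summit.NavierStokesRegularity.FluidComputer.AbcClassI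
open Summit.NavierStokesRegularity.FluidComputer.AbcClassII (Fam crossForm Orbit onormSq)
open Summit.NavierStokesRegularity.FluidComputer.CertificateAbcSpectrum

/-- The class-I abscissa of record at `R = 500` lies left of the `Row5001C` enclosure:
`1/4 ≤ Row5001C.lamRe − Row5001C.rho` (`0.25 ≤ 0.28536… − 5.9·10⁻⁹`). -/
theorem a_le_row5001C : (1 / 4 : ℝ) ≤ ((Row5001C.lamRe : ℚ) : ℝ) - ((Row5001C.rho : ℚ) : ℝ) := by
  have h : (1 / 4 : ℚ) ≤ Row5001C.lamRe - Row5001C.rho := by norm_num [Row5001C.lamRe, Row5001C.rho]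
  have h' : ((1 / 4 : ℚ) : ℝ) ≤ ((Row5001C.lamRe - Row5001C.rho : ℚ) : ℝ) := by exact_mod_cast h
  push_cast at h'
  linarith

section Row

variable (wf : AbcClassI.Idx → Fam)
variable (hws : ∀ i : AbcClassI.Idx, ∀ k ∉ i.1.1, wf i k = 0)
variable (hwt : ∀ (i : AbcClassI.Idx) (k : Fin 3 → ℤ), ∑ j : Fin 3, ((k j : ℤ) : ℂ) * wf i k j = 0)
variable (hwI : ∀ i : AbcClassI.Idx, IsClassI (wf i))
variable (hwon : ∀ (O : Orbit) (a b : Fin (AbcClassI.odim O)),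
  ∑ k ∈ O.1, (inner ℂ (wf ⟨O, a⟩ k) (wf ⟨O, b⟩ k) : ℂ) = if a = b then 1 else 0)
variable (amc : AbcClassI.Idx → AbcClassI.Idx → ℂ)
variable (hamc : ∀ i j : AbcClassI.Idx, amc i j =
  ∑ k ∈ i.1.1, (inner ℂ (wf i k) (Torus.lerayCoeff k (crossForm 1 1 1 (wf j) k)) : ℂ))

include hws hwt hwI hwon hamc in
/-- **R = 500, CLASS I: EXACTLY THE HOPF PAIR — IMPLEMENTATION 2's INERTIA cell `(500, I, 1/4, 2; 36, 37)`.**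
The T2 row `Row5001C` (complex orbit bases `wf`, hypotheses VERBATIM cert-3's) AND (R1)(R2) of the class-I cell on
`AbcClassI.amat` (VERBATIM `AbcInertiaCIRows.R500I_rL36_rH37_card_le_two`) IMPLY: `λ⋆` with
`|λ⋆ − λ̃| ≤ Row5001C.rho`, `Row5001C.lamRe − Row5001C.rho ≤ Re λ⋆`, `Im λ⋆ > 0`, classical CLASS-I eigenfunctions at
`λ⋆` and `conj λ⋆`, and EVERY classical class-I eigenpair `(z, u)` with `Re z ≥ 1/4` has `z = λ⋆ ∨ z = conj λ⋆`.
MODEL; conditional on the two certifier audits and AUDIT-BASIS. -/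
theorem R500I_exactly_pair_i4
    (vt : AbcClassI.Idx → ℂ) (hvt0 : ∀ i, i ∉ AbcClassI.cubeIdx 112 → vt i = 0)
    (hres : ∑ i ∈ AbcClassI.cubeIdx 112 ∪ (AbcClassI.cubeIdx 112).biUnion AbcClassI.nbrIdx,
      ‖(if i ∈ AbcClassI.cubeIdx 112 then (((((Row5001C.lamRe : ℚ) : ℝ) : ℂ) + (((Row5001C.lamIm : ℚ) : ℝ) : ℂ) * Complex.I) - ((-(onormSq i.1 / 500) : ℝ) : ℂ)) * vt i
          else 0) - ∑ j ∈ AbcClassI.cubeIdx 112, amc i j * vt j‖ ^ 2 ≤ ((Row5001C.rnorm : ℚ) : ℝ) ^ 2)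
    (hntb : ∑ i ∈ AbcClassI.cubeIdx 112 \ AbcClassI.cubeIdx 28, ‖vt i‖ ^ 2 ≤
      (((8161754834082577 : ℚ) / 1152921504606846976 : ℚ) : ℝ) ^ 2)
    (Binv : ((↥(AbcClassI.cubeIdx 28) → ℂ) × ℂ) →ₗ[ℂ] ((↥(AbcClassI.cubeIdx 28) → ℂ) × ℂ))
    (hBinv : ∀ (c : ↥(AbcClassI.cubeIdx 28) → ℂ) (m : ℂ),
      Binv (fun i : ↥(AbcClassI.cubeIdx 28) =>
          (((((Row5001C.lamRe : ℚ) : ℝ) : ℂ) + (((Row5001C.lamIm : ℚ) : ℝ) : ℂ) * Complex.I) - ((-(onormSq i.1.1 / 500) : ℝ) : ℂ)) * c i -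
          ∑ j : ↥(AbcClassI.cubeIdx 28), amc i j * c j + m * vt i,
        ∑ i : ↥(AbcClassI.cubeIdx 28), conj (vt i) * c i) = (c, m))
    (hαM : ∀ (c : ↥(AbcClassI.cubeIdx 28) → ℂ) (g : ℂ),
      ∑ j : ↥(AbcClassI.cubeIdx 28), ‖(Binv (c, g)).1 j‖ ^ 2 + ‖(Binv (c, g)).2‖ ^ 2 ≤
        ((Row5001C.alpha0 : ℚ) : ℝ) ^ 2 * (∑ i : ↥(AbcClassI.cubeIdx 28), ‖c i‖ ^ 2 + ‖g‖ ^ 2))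
    (hβBM : ∀ w : AbcClassI.Idx → ℂ,
      ∑ j : ↥(AbcClassI.cubeIdx 28), ‖(Binv (fun i : ↥(AbcClassI.cubeIdx 28) => -∑ j ∈ AbcClassI.nbrIdx i \ AbcClassI.cubeIdx 28,
          amc i j * w j, 0)).1 j‖ ^ 2 +
        ‖(Binv (fun i : ↥(AbcClassI.cubeIdx 28) => -∑ j ∈ AbcClassI.nbrIdx i \ AbcClassI.cubeIdx 28,
          amc i j * w j, 0)).2‖ ^ 2 ≤
        ((Row5001C.betaB : ℚ) : ℝ) ^ 2 * ∑ j ∈ (AbcClassI.cubeIdx 28).biUnion AbcClassI.nbrIdx \ AbcClassI.cubeIdx 28, ‖w j‖ ^ 2)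
    (hβCM : ∀ (c : ↥(AbcClassI.cubeIdx 28) → ℂ) (g : ℂ),
      ∑ i ∈ ((AbcClassI.cubeIdx 28).biUnion AbcClassI.nbrIdx ∪ AbcClassI.cubeIdx 112) \ AbcClassI.cubeIdx 28,
        ‖-∑ j : ↥(AbcClassI.cubeIdx 28), amc i j * (Binv (c, g)).1 j +
          (Binv (c, g)).2 * vt i‖ ^ 2 ≤
        ((Row5001C.betaC : ℚ) : ℝ) ^ 2 * (∑ i : ↥(AbcClassI.cubeIdx 28), ‖c i‖ ^ 2 + ‖g‖ ^ 2))
    (hgBM : ∀ w : AbcClassI.Idx → ℂ,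
      ‖(Binv (fun i : ↥(AbcClassI.cubeIdx 28) => ∑ j ∈ AbcClassI.nbrIdx i \ AbcClassI.cubeIdx 28,
          amc i j * w j, 0)).2‖ ^ 2 ≤
        (((3449790300190025 : ℚ) / 2251799813685248 : ℚ) : ℝ) ^ 2 *
          ∑ j ∈ (AbcClassI.cubeIdx 28).biUnion AbcClassI.nbrIdx \ AbcClassI.cubeIdx 28, ‖w j‖ ^ 2)
    (hshellM : ∀ w : AbcClassI.Idx → ℂ, (∀ i ∈ AbcClassI.cubeIdx 28, w i = 0) →
      (((4982293683959657 : ℚ) / 9007199254740992 : ℚ) : ℝ) * ∑ i ∈ AbcClassI.cubeIdx (28 + 1) \ AbcClassI.cubeIdx 28, ‖w i‖ ^ 2 ≤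
        ∑ i ∈ AbcClassI.cubeIdx (28 + 1) \ AbcClassI.cubeIdx 28,
          (((((Row5001C.lamRe : ℚ) : ℝ) : ℂ) + (((Row5001C.lamIm : ℚ) : ℝ) : ℂ) * Complex.I).re - (-(onormSq i.1 / 500)) - Real.sqrt 2) * ‖w i‖ ^ 2 -
        RCLike.re (∑ i ∈ (AbcClassI.cubeIdx 28).biUnion AbcClassI.nbrIdx \ AbcClassI.cubeIdx 28,
          conj (∑ j : ↥(AbcClassI.cubeIdx 28), amc i j *
            (Binv (fun i : ↥(AbcClassI.cubeIdx 28) => ∑ j ∈ AbcClassI.nbrIdx i \ AbcClassI.cubeIdx 28,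
              amc i j * w j, 0)).1 j) * w i))
    {HL HH HB : Finset AbcClassI.Idx}
    (hHL : ∀ i : AbcClassI.Idx, i ∈ HL ↔ onormSq i.1 ≤ (36 : ℝ) ^ 2)
    (hHH : ∀ i : AbcClassI.Idx, i ∈ HH ↔ onormSq i.1 ≤ (37 : ℝ) ^ 2)
    (hHB : ∀ i : AbcClassI.Idx, i ∈ HB ↔ (37 : ℝ) ^ 2 < onormSq i.1 ∧ onormSq i.1 ≤ ((37 : ℝ) + 1) ^ 2)
    (GH Ah : Matrix ↥HH ↥HH ℝ) (AHB : Matrix ↥HH ↥HB ℝ) (ABH : Matrix ↥HB ↥HH ℝ) (E : ↥HB → ℝ)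
    (V : Matrix ↥HH (Fin 2) ℝ) (hGH : GHᵀ = GH)
    (hAh : Ah = Matrix.of fun i j : ↥HH =>
      (if i = j then -(onormSq i.1.1 / (500 : ℝ)) - (1 / 4 : ℝ) else 0) + AbcClassI.amat i.1 j.1)
    (hAHB : AHB = Matrix.of fun (i : ↥HH) (l : ↥HB) => AbcClassI.amat i.1 l.1)
    (hABH : ABH = Matrix.of fun (l : ↥HB) (i : ↥HH) => AbcClassI.amat l.1 i.1)
    (hE : E = fun l : ↥HB => onormSq l.1.1 / (500 : ℝ) + (1 / 4 : ℝ) - Real.sqrt 2)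
    (hR1 : ∀ x : ↥HH → ℝ, x ≠ 0 →
      x ⬝ᵥ ((GH * Ah + Ahᵀ * GH + (1 / 2 : ℝ) • ((GH * AHB + ABHᵀ) * Matrix.diagonal (fun l => (E l)⁻¹) *
        (GH * AHB + ABHᵀ)ᵀ)) *ᵥ x) < 0)
    (hR2 : ∀ x : ↥HH → ℝ, 0 ≤ x ⬝ᵥ ((GH + V * Vᵀ) *ᵥ x)) :
    ∃ lam : ℂ, ‖lam - ((((Row5001C.lamRe : ℚ) : ℝ) : ℂ) + (((Row5001C.lamIm : ℚ) : ℝ) : ℂ) * Complex.I)‖ ≤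
        ((Row5001C.rho : ℚ) : ℝ) ∧ ((Row5001C.lamRe : ℚ) : ℝ) - ((Row5001C.rho : ℚ) : ℝ) ≤ lam.re ∧ 0 < lam.im ∧
      (∃ u : UnitAddTorus (Fin 3) → EuclideanSpace ℂ (Fin 3),
        Torus.LinNSResolventRel (1 / (2 * Real.pi * 500)) (Torus.abcFlow 1 1 1) (2 * Real.pi * lam) u 0 ∧
          u ≠ 0 ∧ IsClassI (mFourierCoeff u)) ∧
      (∃ u : UnitAddTorus (Fin 3) → EuclideanSpace ℂ (Fin 3),
        Torus.LinNSResolventRel (1 / (2 * Real.pi * 500)) (Torus.abcFlow 1 1 1) (2 * Real.pi * conj lam) u 0 ∧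
          u ≠ 0 ∧ IsClassI (mFourierCoeff u)) ∧
      ∀ (z : ℂ) (u : UnitAddTorus (Fin 3) → EuclideanSpace ℂ (Fin 3)),
        Torus.LinNSResolventRel (1 / (2 * Real.pi * 500)) (Torus.abcFlow 1 1 1) (2 * Real.pi * z) u 0 → u ≠ 0 →
          IsClassI (mFourierCoeff u) → (1 / 4 : ℝ) ≤ z.re → z = lam ∨ z = conj lam := by
  obtain ⟨lam, hclose, hrelo, -, him, hpair, hpairc, -, -⟩ :=
    AbcClassIEigenpair.row5001C_classI_eigenpairs_of_complex_bases wf hws hwt hwI hwon amc hamc vt hvt0 hres hntb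
      Binv hBinv hαM hβBM hβCM hgBM hshellM
  exact exactly_pair_of_row_of_cell (a := 1 / 4) a_le_row5001C
    (fun z hz u hu hu0 hI hre => R500I_rL36_rH37_card_le_two hHL hHH hHB GH Ah AHB ABH E V hGH hAh hAHB hABH hE hR1 hR2
      z hz u hu hu0 hI hre)
    lam hclose hrelo him hpair hpairc

end Row

end Summit.NavierStokesRegularity.FluidComputer.AbcInertiaCI

end
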